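import Mathlib
import Summits.ResolutionOfSingularities.ResolutionOfSingularities.Theorems.RadicialJungCleanModelsKK05MonomialFormSepGenHolds
import Summits.ResolutionOfSingularities.ResolutionOfSingularities.Theorems.RadicialJungCleanModelsLocalMonomializationPerfectSubfield
import HarnessLib

/-!
# Route `RadicialJung`, crux `CleanModels` (stmt-15917), line `Sketch` rev 35, stub 7 `stub_cleanModelsDimGEFour`: the Abhyankar column of the
# local-uniformization input over ground fields finitely generated over a PERFECT field — inseparable residue fields included — UNCONDITIONAL

Explicit-unit seat `decomp-res-hand-1` g4 (hand 1, «direct: discharge printed inputs by name»).  OURS; nothing here proves resolution of singularities in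
characteristic `p`.

hand-2 g3 reduced the local-uniformization-with-monomialization input `hMono_d` of stub 7 at places that are Abhyankar over a subfield `k₀ ⊆ k` with
`κ(O)/k₀` separably generated (✓ `localMonomialization_at_abhyankarPlace_of_subfield`, ground-field descent) — in particular at EVERY Abhyankar place when `k`
is finitely generated over a perfect `k₀` (✓ `localMonomialization_at_abhyankarPlace_of_perfectSubfield`) — to the PRINTED general form
`Literature.AlgebraicGeometry.Resolution.KnafKuhlmann2005_Thm11_monomialFormSepGen` of Knaf–Kuhlmann 2005 Thm. 1.1 with monomial clause.  That fact is now a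
THEOREM (✓ `KK05ValueBasis.knafKuhlmann2005_Thm11_monomialFormSepGen_holds`, this seat); this file plugs it in:

* `KK05ValueBasis.localMonomialization_at_abhyankarPlace_of_subfield_holds` — hand-2 g3's theorem minus its fact hypothesis.
* `KK05ValueBasis.localMonomialization_at_abhyankarPlace_of_perfectSubfield_holds` — idem: `k₀` perfect, `k = k₀(T)`, `O` Abhyankar over `k` with ANY
  residue field ⟹ local monomialization of every finite `Z ⊆ A` along `O` on a finitely generated `A ⊆ A' ⊆ O` regular at the centre.
* `KK05ValueBasis.localMonomialization_of_nonAbhyankarRes_of_perfectSubfield` — the census cut: over such `k`, the input `hMono` at `O` needs to be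
  supplied only when `O` is NOT Abhyankar (positive transcendence defect) — that residue is local uniformization in dimension `d` at non-Abhyankar
  valuations, open for `d ≥ 4`.

Structural bookkeeping + one discharge plugged in; counted 0.
-/

noncomputable section

set_option linter.dupNamespace false -- mandated namespace of this single-conjunct summit

open IsLocalRing
open Literature.AlgebraicGeometry.Resolution

namespace Summit.ResolutionOfSingularities.ResolutionOfSingularities.Theorems.RadicialJung.CleanModels

namespace KK05ValueBasis

/-- **Local monomialization at a place Abhyankar over a subfield `k₀ ⊆ k` with `κ(O)/k₀` separably generated — UNCONDITIONAL** (hand-2 g3's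
✓ `localMonomialization_at_abhyankarPlace_of_subfield` with its printed input discharged by ✓ `knafKuhlmann2005_Thm11_monomialFormSepGen_holds`).
[cite: KnafKuhlmann2005, Thm. 1.1] -/
theorem localMonomialization_at_abhyankarPlace_of_subfield_holds
    (k₀ k K : Type) [Field k₀] [Field k] [Field K] [Algebra k₀ k] [Algebra k K] [Algebra k₀ K] [IsScalarTower k₀ k K]
    (T : Finset k) (hT : IntermediateField.adjoin k₀ (T : Set k) = ⊤)
    (O : ValuationSubring K) (A : Subalgebra k K) (hAO : A.toSubring ≤ O.toSubring) (hAfg : A.FG)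
    (hfrac : IsFractionRing A K)
    (hk₀ : ∀ c : k₀, algebraMap k₀ K c ∈ O) (htd₀ : transcendenceDefect k₀ O hk₀ = 0)
    (hsep₀ : letI : Algebra k₀ (IsLocalRing.ResidueField O) :=
        ((IsLocalRing.residue O).comp ((algebraMap k₀ K).codRestrict O hk₀)).toAlgebra
      ∃ s : Finset (IsLocalRing.ResidueField O),
        IsTranscendenceBasis k₀ ((↑) : s → IsLocalRing.ResidueField O) ∧
        Algebra.IsSeparable (IntermediateField.adjoin k₀ (s : Set (IsLocalRing.ResidueField O))) (IsLocalRing.ResidueField O))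
    (Z : Finset K) (hZ : ∀ z ∈ Z, z ∈ A) :
    ∃ (A' : Subalgebra k K), A'.toSubring ≤ O.toSubring ∧ A ≤ A' ∧ A'.FG ∧
    ∃ (_ : IsRegularLocalRing (locAtCentre A'.toSubring O)) (e : ℕ) (a : Fin e → ↥(locAtCentre A'.toSubring O)),
      Ideal.span (Set.range a) = IsLocalRing.maximalIdeal ↥(locAtCentre A'.toSubring O) ∧
      ringKrullDim ↥(locAtCentre A'.toSubring O) = (e : WithBot ℕ∞) ∧
      ∀ z ∈ Z, z ≠ 0 → ∃ (v : ↥(locAtCentre A'.toSubring O)) (μ : Fin e → ℕ), IsUnit v ∧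
        z = (v : K) * ∏ i, ((a i : ↥(locAtCentre A'.toSubring O)) : K) ^ (μ i) :=
  localMonomialization_at_abhyankarPlace_of_subfield knafKuhlmann2005_Thm11_monomialFormSepGen_holds
    k₀ k K T hT O A hAO hAfg hfrac hk₀ htd₀ hsep₀ Z hZ

/-- **Local monomialization at EVERY Abhyankar place over a ground field finitely generated over a perfect field — UNCONDITIONAL**
(hand-2 g3's ✓ `localMonomialization_at_abhyankarPlace_of_perfectSubfield` with its printed input discharged): fields `k₀ → k → K`, `k₀` perfect,
`k = k₀(T)`; `A ⊆ O` a finitely generated `k`-subalgebra with `Frac A = K`; `O` of transcendence defect `0` over `k` (its residue field may be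
INSEPARABLE over `k`); then every finite `Z ⊆ A` is monomialized along `O` on a finitely generated `A ⊆ A' ⊆ O` regular at the centre.
[cite: KnafKuhlmann2005, Thm. 1.1 and Cor. 2.2] -/
theorem localMonomialization_at_abhyankarPlace_of_perfectSubfield_holds
    (k₀ k K : Type) [Field k₀] [PerfectField k₀] [Field k] [Field K] [Algebra k₀ k] [Algebra k K] [Algebra k₀ K]
    [IsScalarTower k₀ k K]
    (T : Finset k) (hT : IntermediateField.adjoin k₀ (T : Set k) = ⊤)
    (O : ValuationSubring K) (A : Subalgebra k K) (hAO : A.toSubring ≤ O.toSubring) (hAfg : A.FG)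
    (hfrac : IsFractionRing A K)
    (hk : ∀ c : k, algebraMap k K c ∈ O) (htd : transcendenceDefect k O hk = 0)
    (Z : Finset K) (hZ : ∀ z ∈ Z, z ∈ A) :
    ∃ (A' : Subalgebra k K), A'.toSubring ≤ O.toSubring ∧ A ≤ A' ∧ A'.FG ∧
    ∃ (_ : IsRegularLocalRing (locAtCentre A'.toSubring O)) (e : ℕ) (a : Fin e → ↥(locAtCentre A'.toSubring O)),
      Ideal.span (Set.range a) = IsLocalRing.maximalIdeal ↥(locAtCentre A'.toSubring O) ∧
      ringKrullDim ↥(locAtCentre A'.toSubring O) = (e : WithBot ℕ∞) ∧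
      ∀ z ∈ Z, z ≠ 0 → ∃ (v : ↥(locAtCentre A'.toSubring O)) (μ : Fin e → ℕ), IsUnit v ∧
        z = (v : K) * ∏ i, ((a i : ↥(locAtCentre A'.toSubring O)) : K) ^ (μ i) :=
  localMonomialization_at_abhyankarPlace_of_perfectSubfield knafKuhlmann2005_Thm11_monomialFormSepGen_holds
    k₀ k K T hT O A hAO hAfg hfrac hk htd Z hZ

/-- **The census cut for stub 7 over ground fields finitely generated over a perfect field**: the local-uniformization-with-monomialization input at a
valuation ring `O` has to be SUPPLIED only when `O` is not Abhyankar over `k` (positive transcendence defect — local uniformization at non-Abhyankar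
valuations, open in dimension `≥ 4`); at Abhyankar places it is the theorem `localMonomialization_at_abhyankarPlace_of_perfectSubfield_holds`.
[cite: KnafKuhlmann2005, Thm. 1.1] [cite: CutkoskyMourtada2019, Def. 1.2] -/
theorem localMonomialization_of_nonAbhyankarRes_of_perfectSubfield
    (k₀ k K : Type) [Field k₀] [PerfectField k₀] [Field k] [Field K] [Algebra k₀ k] [Algebra k K] [Algebra k₀ K]
    [IsScalarTower k₀ k K]
    (T : Finset k) (hT : IntermediateField.adjoin k₀ (T : Set k) = ⊤)
    (O : ValuationSubring K) (A : Subalgebra k K) (hAO : A.toSubring ≤ O.toSubring) (hAfg : A.FG)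
    (hfrac : IsFractionRing A K)
    (hk : ∀ c : k, algebraMap k K c ∈ O)
    (Z : Finset K) (hZ : ∀ z ∈ Z, z ∈ A)
    (hRes : transcendenceDefect k O hk ≠ 0 →
      ∃ (A' : Subalgebra k K), A'.toSubring ≤ O.toSubring ∧ A ≤ A' ∧ A'.FG ∧
      ∃ (_ : IsRegularLocalRing (locAtCentre A'.toSubring O)) (e : ℕ) (a : Fin e → ↥(locAtCentre A'.toSubring O)),
        Ideal.span (Set.range a) = IsLocalRing.maximalIdeal ↥(locAtCentre A'.toSubring O) ∧
        ringKrullDim ↥(locAtCentre A'.toSubring O) = (e : WithBot ℕ∞) ∧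
        ∀ z ∈ Z, z ≠ 0 → ∃ (v : ↥(locAtCentre A'.toSubring O)) (μ : Fin e → ℕ), IsUnit v ∧
          z = (v : K) * ∏ i, ((a i : ↥(locAtCentre A'.toSubring O)) : K) ^ (μ i)) :
    ∃ (A' : Subalgebra k K), A'.toSubring ≤ O.toSubring ∧ A ≤ A' ∧ A'.FG ∧
    ∃ (_ : IsRegularLocalRing (locAtCentre A'.toSubring O)) (e : ℕ) (a : Fin e → ↥(locAtCentre A'.toSubring O)),
      Ideal.span (Set.range a) = IsLocalRing.maximalIdeal ↥(locAtCentre A'.toSubring O) ∧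
      ringKrullDim ↥(locAtCentre A'.toSubring O) = (e : WithBot ℕ∞) ∧
      ∀ z ∈ Z, z ≠ 0 → ∃ (v : ↥(locAtCentre A'.toSubring O)) (μ : Fin e → ℕ), IsUnit v ∧
        z = (v : K) * ∏ i, ((a i : ↥(locAtCentre A'.toSubring O)) : K) ^ (μ i) := by
  by_cases htd : transcendenceDefect k O hk = 0
  · exact localMonomialization_at_abhyankarPlace_of_perfectSubfield_holds k₀ k K T hT O A hAO hAfg hfrac hk htd Z hZ
  · exact hRes htd

end KK05ValueBasis

end Summit.ResolutionOfSingularities.ResolutionOfSingularities.Theorems.RadicialJung.CleanModels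

end
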